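import Summits.HodgeConjecture.Ring2.NonSimpleFourfoldsHodge
import HarnessLib

/-!
# Non-simple complex abelian FOURFOLDS: Moonen–Zarhin 1999 Thm. 0.1 (4) with case (a) EXACTLY AS PRINTED — the elliptic factor of case (a) has complex multiplication

Cell `pub-hodge-ring2` (HONEST FRAMING: research route conditional on HC_CM; not a corollary; Q11.4-sentence-2 already
refuted in dim ≥ 3), Literature lane (lit seat, generation 59; addendum to gen 58's union `Ring2/NonSimpleFourfoldsHodge`).
Theorems only (no definition, no named fact, no `sorry`); nothing here assumes HC_CM. NEW as stated, hence under `Summits/`.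

Moonen–Zarhin, Math. Ann. **315** (1999), case (a) (chunk p0001 L77–L81 [corpus: paper:arxiv-math_9901113]): «The abelian
variety `X` is isogenous to a product `X₁ × X₂` where `X₁` is an elliptic curve WITH COMPLEX MULTIPLICATION by an imaginary
quadratic field `k` and where `X₂` is a simple abelian threefold such that there exists an embedding `k ↪ End⁰(X₂)`»;
Thm. 0.1 (4): outside (a)–(d), `B•(Xⁿ) = D•(Xⁿ)` for all `n`. The gen-58 union
`Ring2.NonSimpleFourfolds.isStablyNondegenerate_of_dim_eq_four_of_not_isSimple` renders «not (a)» WITHOUT the words «with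
complex multiplication» (`¬ ∃ E T, E.dim = 1 ∧ T.IsSimple ∧ T.dim = 3 ∧ E, T ≼ X ∧ Nonempty (End⁰(E) →+* End⁰(T))`), a
hypothesis STRONGER than printed: since `ℚ = End⁰(E)` of a curve without complex multiplication maps to every `End⁰(T)`,
it also excludes `E × T` for `E` non-CM and `T` simple — which IS stably nondegenerate (Lemma (3.4); the tree's R22 row
`isStablyNondegenerate_nonCMCurve_prod_threefold`). This file states the theorem with the printed hypothesis
(`IsOfCMType E` inside the negated existential) and derives it from the two halves: `X` of CM type — an elliptic isogeny
factor of a CM variety is of CM type (Milne 1999 §2), so the CorCM form of the hypothesis holds; `X` not of CM type — the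
Literature theorem (5.4) `isStablyNondegenerate_of_dim_eq_four_of_not_isSimple_of_not_isOfCMType`, whose «not (a)» already
carries `IsOfCMType E`.

* `isStablyNondegenerate_of_dim_eq_four_of_not_isSimple_of_not_caseA` — Thm. 0.1 (4) for EVERY non-simple fourfold outside
  the printed case (a); `hodgeConjectureFor_powSucc_of_dim_eq_four_of_not_isSimple_of_not_caseA` (all powers),
  `…_of_isIsogenous_powSucc_…`; `isStablyNondegenerate_curve_prod_threefold_of_not_caseA` (`E × T`, any curve, any
  threefold, outside printed (a) relative to `E × T`).

## References
* [MoonenZarhin1999LowDim] B. Moonen, Yu. Zarhin, Math. Ann. 315 (1999) 711–733: case (a) and Thm. 0.1 (4) (chunk p0001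
  L77–L121), §5 (5.4)–(5.5) (chunk p0009 L83–L108) [corpus: paper:arxiv-math_9901113]. [cite: MoonenZarhin1999LowDim, Thm. 0.1 (4) and §5 (5.4)–(5.5)]
* [Milne1999] J. S. Milne, Compositio Math. 117 (1999), §2 p. 54 (quotients of CM abelian varieties are CM). [cite: Milne1999, §2 p. 54]
* [MumfordAV1970] D. Mumford, *Abelian Varieties* (1970), §19 Thm. 1 and Cor. 1–2 (pp. 173–174). [cite: MumfordAV1970, §19 Thm. 1 (pp. 173–174)]
-/

noncomputable section

open CategoryTheory CategoryTheory.Limits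

namespace Summit.HodgeConjecture.Ring2.NonSimpleFourfolds

open Literature.AlgebraicGeometry.Motives (AbelianVariety)
open Literature.AlgebraicGeometry.Motives.AbelianVariety
open Literature.AlgebraicGeometry.HodgeTheory
open Literature.AlgebraicGeometry.Milne1999
open Summit.HodgeConjecture.CorCM
open Summit.HodgeConjecture.CorCM.Domination

variable {X E T : AbelianVariety ℂ}

/-- **MOONEN–ZARHIN Thm. 0.1 (4) FOR NON-SIMPLE FOURFOLDS, case (a) AS PRINTED — UNCONDITIONAL.** Every non-simple complex
abelian fourfold `X` such that no elliptic curve `E` WITH COMPLEX MULTIPLICATION and simple threefold `T`, both isogeny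
factors of `X`, admit `End⁰(E) ↪ End⁰(T)`, is stably nondegenerate: `B•(Xⁿ) = D•(Xⁿ)` for all `n`. `X` of CM type: every
elliptic isogeny factor is of CM type (`IsOfCMType.of_comp_eq_nsmul_id`), so the gen-58 union applies; `X` not of CM type:
the Literature theorem (5.4) with its isogeny-form hypothesis. [cite: MoonenZarhin1999LowDim, Thm. 0.1 (4) and §5 (5.4)–(5.5)]
[cite: Milne1999, §2 p. 54] -/
theorem isStablyNondegenerate_of_dim_eq_four_of_not_isSimple_of_not_caseA (hX4 : X.dim = 4) (hX : ¬ X.IsSimple)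
    (hna : ¬ ∃ E T : AbelianVariety ℂ, E.dim = 1 ∧ IsOfCMType E ∧ T.IsSimple ∧ T.dim = 3 ∧
      AVDominatedBy E X ∧ AVDominatedBy T X ∧ Nonempty (E.endAlgebra →+* T.endAlgebra)) :
    IsStablyNondegenerate X := by
  by_cases hcm : IsOfCMType X
  · refine isStablyNondegenerate_of_dim_eq_four_of_not_isSimple hX4 hX ?_
    rintro ⟨E, T, hE, hTs, hT3, hEX, hTX, hne⟩
    obtain ⟨s, π, N, hN, hsπ⟩ := hEX
    exact hna ⟨E, T, hE, hcm.of_comp_eq_nsmul_id s π hN hsπ, hTs, hT3, ⟨s, π, N, hN, hsπ⟩, hTX, hne⟩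
  · refine isStablyNondegenerate_of_dim_eq_four_of_not_isSimple_of_not_isOfCMType hX4 hX hcm ?_
    intro E T hE hT3 hTs hEcm hiso
    by_contra hne
    rw [not_isEmpty_iff] at hne
    obtain ⟨g, hg⟩ := hiso
    exact hna ⟨E, T, hE, hEcm, hTs, hT3, (SliceExhaustion.avDominatedBy_prod_left E T).trans_isIsogeny_hom hg,
      (avDominatedBy_prod_right E T).trans_isIsogeny_hom hg, hne⟩

/-- **The Hodge conjecture for every power of every non-simple fourfold outside the printed case (a) — UNCONDITIONAL.**
[cite: MoonenZarhin1999LowDim, Thm. 0.1 (4)] -/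
theorem hodgeConjectureFor_powSucc_of_dim_eq_four_of_not_isSimple_of_not_caseA (hX4 : X.dim = 4) (hX : ¬ X.IsSimple)
    (hna : ¬ ∃ E T : AbelianVariety ℂ, E.dim = 1 ∧ IsOfCMType E ∧ T.IsSimple ∧ T.dim = 3 ∧
      AVDominatedBy E X ∧ AVDominatedBy T X ∧ Nonempty (E.endAlgebra →+* T.endAlgebra)) (N : ℕ) :
    HodgeConjectureFor (X.powSucc N).dim (X.powSucc N).X :=
  (isStablyNondegenerate_of_dim_eq_four_of_not_isSimple_of_not_caseA hX4 hX hna).hodgeConjectureFor_powSucc N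

/-- **The Hodge conjecture for everything isogenous to a power of such a fourfold.** [cite: MoonenZarhin1999LowDim, Thm. 0.1 (4)]
[cite: MumfordAV1970, §19 Thm. 1 (pp. 173–174)] -/
theorem hodgeConjectureFor_of_isIsogenous_powSucc_of_dim_eq_four_of_not_isSimple_of_not_caseA (hX4 : X.dim = 4)
    (hX : ¬ X.IsSimple)
    (hna : ¬ ∃ E T : AbelianVariety ℂ, E.dim = 1 ∧ IsOfCMType E ∧ T.IsSimple ∧ T.dim = 3 ∧
      AVDominatedBy E X ∧ AVDominatedBy T X ∧ Nonempty (E.endAlgebra →+* T.endAlgebra))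
    {Y : AbelianVariety ℂ} {N : ℕ} (hY : AbelianVariety.IsIsogenous Y (X.powSucc N)) : HodgeConjectureFor Y.dim Y.X :=
  (isStablyNondegenerate_of_dim_eq_four_of_not_isSimple_of_not_caseA hX4 hX hna).hodgeConjectureFor_of_isIsogenous_powSucc hY

/-- **`E × T` for ANY elliptic curve `E` and ANY abelian threefold `T`, outside the printed case (a) relative to `E × T`,
is stably nondegenerate — UNCONDITIONAL** (for `E` without complex multiplication, or `T` non-simple, the hypothesis only
concerns factors of `T`; compare the tree's `isStablyNondegenerate_nonCMCurve_prod_threefold` (no hypothesis) and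
`isStablyNondegenerate_curve_prod_of_isSimple_threefold` (`T` simple)). [cite: MoonenZarhin1999LowDim, Thm. 0.1 (4), Lemma (3.4), Prop. (3.8)] -/
theorem isStablyNondegenerate_curve_prod_threefold_of_not_caseA (hE : E.dim = 1) (hT3 : T.dim = 3)
    (hna : ¬ ∃ E₀ T₀ : AbelianVariety ℂ, E₀.dim = 1 ∧ IsOfCMType E₀ ∧ T₀.IsSimple ∧ T₀.dim = 3 ∧
      AVDominatedBy E₀ (E.prod T) ∧ AVDominatedBy T₀ (E.prod T) ∧ Nonempty (E₀.endAlgebra →+* T₀.endAlgebra)) :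
    IsStablyNondegenerate (E.prod T) :=
  isStablyNondegenerate_of_dim_eq_four_of_not_isSimple_of_not_caseA (by rw [dim_prod]; omega)
    (not_isSimple_prod_of_dim_pos (by omega) (by omega)) hna

end Summit.HodgeConjecture.Ring2.NonSimpleFourfolds
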